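import Literature.Geometry.Symplectic.SteinDomain
import Literature.Geometry.Kaehler.ManifoldFormsPullback
import Literature.Geometry.Manifold.OpenSubmanifoldMFDeriv
import Literature.Topology.FourManifolds.Handles
import HarnessLib

/-!
# Stein structures on connected components; Morse functions on open submanifolds

Topic `Literature/Geometry/Symplectic`; fact seat
`provefact-Literature.Geometry.Symplectic.Gompf1998` for Eliashberg's theorem without `2`-handles,
`Literature.Geometry.Symplectic.Gompf1998_thm13_noTwoHandles` (`SteinHandlebodies.lean`), whose
`W` may be **disconnected** (rendering note there: "a disjoint union of Stein domains is a Stein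
domain for `IsSteinDomain`: take the same maximal value of `φ` on every component"), while the
classification of `1`-handlebodies that identifies `W` with a model is for connected manifolds.
This file proves the reduction to components, for the tree's `SteinStructure`/`IsSteinDomain`
(`SteinDomain.lean`) and `IsHandlebodyOfIndexLE` (`Handles.lean`):

* `isSteinDomain_of_components`: if every connected component of the compact `4`-manifold with
  boundary `W` — an open submanifold `compOpens W i` (Mathlib's `TopologicalSpace.Opens`
  manifold structure), compact and connected — is a Stein domain, so is `W`
  (`SteinStructure.ofComponents`);
* `isHandlebodyOfIndexLE_opens`: an open submanifold of a handlebody with handles of index `≤ k`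
  is one (restrict the presenting Morse function: `isMorseAdapted_comp_val`, with the same
  critical points, Hessians `mhessian_comp_val` and indices `morseIndex_comp_val`).

Everything is proved; all of it is the folklore "`T U = T M|_U` for an open submanifold"
(Lee, *Introduction to Smooth Manifolds* (2013), Example 1.26, Prop. 3.9), organised as:

* §1 calculus on `U : Opens M` (any real model with corners): charts of `U` are restricted
  charts (`extChartAt_opens_apply`, `val_extChartAt_symm_eventuallyEq` from Mathlib's
  `TopologicalSpace.Opens.chartAt_subtype_val_symm_eventuallyEq`), local representatives and
  manifold derivatives of restrictions `f ∘ Subtype.val` (`writtenInExtChartAt_comp_val_eventuallyEq`,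
  `mfderiv_comp_val`); the **retraction** `opensRetr : M → U` (identity on `U`) is `C^∞` with
  identity differential at points of `U` (`contMDiffAt_opensRetr`, `mfderiv_opensRetr`), whence:
  smoothness on `M` at points of `U` from smoothness of restrictions, for functions
  (`contMDiffAt_of_comp_val`) and for **vector fields** (`contMDiff_section_restrict`,
  `contMDiffAt_section_of_restrict`, via Mathlib's `ContMDiff.mpullback_vectorField` along the
  inclusion and the retraction); **Lie brackets restrict** (`mlieBracket_restrict`, Mathlib's
  `VectorField.mpullback_mlieBracket`); for the tree's forms, the chart representative and hence
  the chart-wise exterior derivative `Literature.Geometry.Kaehler.mextDeriv` of a restricted form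
  `ι^*β` are those of `β` (`inChart_pullback_val_eventuallyEq`, `mextDeriv_pullback_val_apply`,
  unconditionally); Morse data of restrictions; boundary points of `U` are those of `M`
  (Mathlib's `ModelWithCorners.isBoundaryPoint_iff_isBoundaryPoint_val`).
* §2 `compOpens W i`, the component with index `i : ConnectedComponents W` as an open
  submanifold (compact, connected), `toComp x : compOpens W (mk x)`.
* §3 the glued structure `glueJ`, `glueφ` from Stein structures `T i` on the components
  (`φ` normalised to `max = 0` on each component) and the verification of the axioms of
  `SteinStructure W`, each being local or componentwise.

## References

* J. M. Lee, *Introduction to Smooth Manifolds*, 2nd ed., GTM 218 (2013), Example 1.26,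
  Prop. 3.9 (open submanifolds). [LeeSmoothManifolds2013]
* R. E. Gompf, *Handlebody construction of Stein surfaces*, Ann. of Math. 148 (1998), 619–693,
  Thm. 1.3. [Gompf1998]
-/

noncomputable section

open scoped Manifold ContDiff Topology
open Set Function Filter VectorField TopologicalSpace

namespace Literature.Geometry.Symplectic

/-! ### §1 Calculus on an open submanifold `U ⊆ M` (charts of `U` are restricted charts of `M`) -/

section Opens

variable {E : Type*} [NormedAddCommGroup E] [NormedSpace ℝ E] {H : Type*} [TopologicalSpace H]
  {I : ModelWithCorners ℝ E H} {M : Type*} [TopologicalSpace M] [ChartedSpace H M]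
  (U : Opens M)

/-- The extended chart of `U` at `x` is the extended chart of `M` at `↑x` composed with the
inclusion (everywhere, as functions). [folklore] -/
theorem extChartAt_opens_apply (x y : U) : extChartAt I x y = extChartAt I (x : M) (y : M) := rfl

/-- **Near the base point, the inverse extended chart of `U` at `x` is that of `M` at `↑x`**
(Mathlib's `TopologicalSpace.Opens.chartAt_subtype_val_symm_eventuallyEq`, moved to `E`).
[folklore] -/
theorem val_extChartAt_symm_eventuallyEq (x : U) :
    ∀ᶠ z in 𝓝 (extChartAt I x x),
      (((extChartAt I x).symm z : U) : M) = (extChartAt I (x : M)).symm z := by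
  have h1 := TopologicalSpace.Opens.chartAt_subtype_val_symm_eventuallyEq (H := H) U (x := x)
  have h2 : ContinuousAt I.symm ((extChartAt I x) x) := I.continuous_symm.continuousAt
  have h3 : I.symm ((extChartAt I x) x) = chartAt H (x : M) x := by
    simp only [extChartAt_coe, Function.comp_apply, ModelWithCorners.left_inv]
    rfl
  rw [ContinuousAt, h3] at h2
  filter_upwards [h2.eventually h1] with z hz
  simp only [Function.comp_apply, TopologicalSpace.Opens.chartAt_eq] at hz
  simp only [extChartAt_coe_symm, Function.comp_apply, TopologicalSpace.Opens.chartAt_eq]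
  exact hz.symm

/-- **Local representatives of restrictions.** For `f : M → N`, the map `f ∘ Subtype.val : U → N`
written in the charts of `U` at `x` and of `N` at `f x` agrees near the base point with `f`
written in the charts of `M` at `↑x` (Lee (2013), Example 1.26, Prop. 3.9). [folklore] -/
theorem writtenInExtChartAt_comp_val_eventuallyEq {E' : Type*} [NormedAddCommGroup E']
    [NormedSpace ℝ E'] {H' : Type*} [TopologicalSpace H'] {I' : ModelWithCorners ℝ E' H'}
    {N : Type*} [TopologicalSpace N] [ChartedSpace H' N] (f : M → N) (x : U) :
    writtenInExtChartAt I I' x (f ∘ Subtype.val) =ᶠ[𝓝 (extChartAt I x x)]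
      writtenInExtChartAt I I' (x : M) f := by
  filter_upwards [val_extChartAt_symm_eventuallyEq (I := I) U x] with z hz
  simp only [writtenInExtChartAt, Function.comp_apply]
  rw [hz]

variable {U}

/-- A restriction `f ∘ Subtype.val : U → N` has at `x` every manifold derivative `f` has at `↑x`.
[folklore] -/
theorem hasMFDerivAt_comp_val {E' : Type*} [NormedAddCommGroup E'] [NormedSpace ℝ E']
    {H' : Type*} [TopologicalSpace H'] {I' : ModelWithCorners ℝ E' H'} {N : Type*}
    [TopologicalSpace N] [ChartedSpace H' N] {f : M → N} {x : U} {f' : E →L[ℝ] E'}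
    (hf : HasMFDerivAt I I' f (x : M) f') : HasMFDerivAt I I' (f ∘ Subtype.val) x f' := by
  refine ⟨hf.1.comp continuous_subtype_val.continuousAt, ?_⟩
  have heq := writtenInExtChartAt_comp_val_eventuallyEq (I := I) (I' := I') U f x
  exact hf.2.congr_of_eventuallyEq (heq.filter_mono nhdsWithin_le_nhds) heq.eq_of_nhds

/-- **`T_x U = T_x M` in coordinates**: the manifold derivative of `f ∘ Subtype.val` at `x` is
that of `f` at `↑x`, for `f` differentiable at `↑x`. [folklore] -/
theorem mfderiv_comp_val {E' : Type*} [NormedAddCommGroup E'] [NormedSpace ℝ E']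
    {H' : Type*} [TopologicalSpace H'] {I' : ModelWithCorners ℝ E' H'} {N : Type*}
    [TopologicalSpace N] [ChartedSpace H' N] {f : M → N} {x : U}
    (hf : MDifferentiableAt I I' f (x : M)) :
    mfderiv I I' (f ∘ Subtype.val) x = mfderiv I I' f (x : M) :=
  (hasMFDerivAt_comp_val hf.hasMFDerivAt).mfderiv

/-! #### The retraction of `M` onto `U` near a point of `U` -/

open Classical in
/-- The *retraction* `M → U` defined near `U`: the identity on `U`, the junk value `x₀`
elsewhere. [folklore] -/
def opensRetr (x₀ : U) (y : M) : U := if hy : y ∈ U then ⟨y, hy⟩ else x₀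

/-- On `U` the retraction is the identity. [folklore] -/
@[simp] theorem opensRetr_val (x₀ y : U) : opensRetr x₀ (y : M) = y := by
  rw [opensRetr, dif_pos y.2]

/-- On `U` the retraction is the identity (membership form). [folklore] -/
theorem opensRetr_of_mem (x₀ : U) {y : M} (hy : y ∈ U) : opensRetr x₀ y = ⟨y, hy⟩ := by
  rw [opensRetr, dif_pos hy]

/-- `Subtype.val ∘ opensRetr = id` near every point of `U`. [folklore] -/
theorem val_opensRetr_eventuallyEq (x₀ y : U) :
    (fun z => ((opensRetr x₀ z : U) : M)) =ᶠ[𝓝 (y : M)] id := by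
  filter_upwards [U.isOpen.mem_nhds y.2] with z hz
  rw [opensRetr_of_mem x₀ hz, id]

/-- The retraction is continuous at points of `U`. [folklore] -/
theorem continuousAt_opensRetr (x₀ y : U) : ContinuousAt (opensRetr x₀) (y : M) := by
  rw [Topology.IsInducing.subtypeVal.continuousAt_iff]
  exact continuousAt_id.congr (val_opensRetr_eventuallyEq x₀ y).symm

/-- **The retraction read in charts is the identity near the base point** (within the model
half-space): `extChartAt y ∘ retr ∘ (extChartAt ↑y)⁻¹ = id` near `extChartAt ↑y ↑y`. [folklore] -/
theorem extChartAt_comp_opensRetr_eventuallyEq (x₀ y : U) :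
    (extChartAt I y ∘ opensRetr x₀ ∘ (extChartAt I (y : M)).symm) =ᶠ[𝓝[range I]
      (extChartAt I (y : M) (y : M))] id := by
  have h1 : ∀ᶠ z in 𝓝 (extChartAt I (y : M) (y : M)), (extChartAt I (y : M)).symm z ∈ U := by
    refine (continuousAt_extChartAt_symm (y : M)).preimage_mem_nhds ?_
    rw [extChartAt_to_inv]
    exact U.isOpen.mem_nhds y.2
  filter_upwards [h1.filter_mono nhdsWithin_le_nhds, extChartAt_target_mem_nhdsWithin (y : M)]
    with z hz hz'
  simp only [comp_apply, id]
  rw [opensRetr_of_mem x₀ hz, extChartAt_opens_apply]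
  exact (extChartAt I (y : M)).right_inv hz'

/-- The retraction read in charts fixes the base point. [folklore] -/
theorem extChartAt_comp_opensRetr_apply_self (x₀ y : U) :
    (extChartAt I y ∘ opensRetr x₀ ∘ (extChartAt I (y : M)).symm) (extChartAt I (y : M) (y : M)) =
      extChartAt I (y : M) (y : M) := by
  simp only [comp_apply]
  rw [extChartAt_to_inv, opensRetr_val, extChartAt_opens_apply]

/-- **The retraction is `C^n` at every point of `U`** (it reads as the identity in charts).
[folklore] -/
theorem contMDiffAt_opensRetr {n : ℕ∞ω} (x₀ y : U) : ContMDiffAt I I n (opensRetr x₀) (y : M) := by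
  rw [contMDiffAt_iff]
  refine ⟨continuousAt_opensRetr x₀ y, ?_⟩
  rw [opensRetr_val]
  exact contDiffWithinAt_id.congr_of_eventuallyEq (extChartAt_comp_opensRetr_eventuallyEq x₀ y)
    (extChartAt_comp_opensRetr_apply_self x₀ y)

/-- **The retraction has identity differential at points of `U`.** [folklore] -/
theorem hasMFDerivAt_opensRetr (x₀ y : U) :
    HasMFDerivAt I I (opensRetr x₀) (y : M) (ContinuousLinearMap.id ℝ E) := by
  refine ⟨continuousAt_opensRetr x₀ y, ?_⟩
  show HasFDerivWithinAt (extChartAt I (opensRetr x₀ (y : M)) ∘ opensRetr x₀ ∘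
    (extChartAt I (y : M)).symm) _ _ _
  rw [opensRetr_val]
  exact (hasFDerivWithinAt_id _ _).congr_of_eventuallyEq
    (extChartAt_comp_opensRetr_eventuallyEq x₀ y) (extChartAt_comp_opensRetr_apply_self x₀ y)

/-- The differential of the retraction at a point of `U` is the identity. [folklore] -/
theorem mfderiv_opensRetr (x₀ y : U) :
    mfderiv I I (opensRetr x₀) (y : M) = ContinuousLinearMap.id ℝ E :=
  (hasMFDerivAt_opensRetr x₀ y).mfderiv

/-- **Smoothness on `M` from smoothness of the restriction**: a map `g : M → N` whose
restriction `g ∘ Subtype.val` is `C^n` at `y : U` is `C^n` at `↑y` (compose with the retraction).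
[folklore] -/
theorem contMDiffAt_of_comp_val {E' : Type*} [NormedAddCommGroup E'] [NormedSpace ℝ E']
    {H' : Type*} [TopologicalSpace H'] {I' : ModelWithCorners ℝ E' H'} {N : Type*}
    [TopologicalSpace N] [ChartedSpace H' N] {n : ℕ∞ω} {g : M → N} {y : U}
    (hg : ContMDiffAt I I' n (g ∘ Subtype.val) y) : ContMDiffAt I I' n g (y : M) := by
  have hg' : ContMDiffAt I I' n (g ∘ Subtype.val) (opensRetr y (y : M)) := by
    rwa [opensRetr_val]
  have h1 : ContMDiffAt I I' n ((g ∘ Subtype.val) ∘ opensRetr y) (y : M) :=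
    hg'.comp (y : M) (contMDiffAt_opensRetr y y)
  refine h1.congr_of_eventuallyEq ?_
  filter_upwards [U.isOpen.mem_nhds y.2] with z hz
  simp only [comp_apply, opensRetr_of_mem y hz]

variable (U) in
/-- The restriction `X|_U` of a vector field of `M` to the open submanifold `U`
(`T_y U = T_y M`). [folklore] -/
def restrictVF (X : (x : M) → TangentSpace I x) : (y : U) → TangentSpace I y := fun y => X (y : M)

/-- Unfolding `restrictVF`. [folklore] -/
@[simp] theorem restrictVF_apply (X : (x : M) → TangentSpace I x) (y : U) :
    restrictVF U X y = X (y : M) := rfl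

/-- **Mathlib's pull-back of a vector field along the inclusion `U → M` is the restriction.**
[folklore] -/
theorem mpullback_val (X : (x : M) → TangentSpace I x) :
    mpullback I I (Subtype.val : U → M) X = restrictVF U X := by
  funext y
  rw [mpullback_apply, Literature.Geometry.Manifold.OpenSubmanifold.mfderiv_subtype_val]
  erw [ContinuousLinearMap.inverse_id]
  rfl

/-- The differential of the inclusion `U → M` is invertible. [folklore] -/
theorem isInvertible_mfderiv_val (y : U) : (mfderiv I I (Subtype.val : U → M) y).IsInvertible := by
  rw [Literature.Geometry.Manifold.OpenSubmanifold.mfderiv_subtype_val]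
  exact ⟨ContinuousLinearEquiv.refl ℝ E, rfl⟩

/-- The differential of the retraction at a point of `U` is the identity (membership form).
[folklore] -/
theorem mfderiv_opensRetr_of_mem (x₀ : U) {z : M} (hz : z ∈ U) :
    mfderiv I I (opensRetr x₀) z = ContinuousLinearMap.id ℝ E :=
  mfderiv_opensRetr x₀ ⟨z, hz⟩

/-- Mathlib's pull-back along the retraction, at a point of `U`, is evaluation. [folklore] -/
theorem mpullback_opensRetr_apply (x₀ : U) (Z : (y : U) → TangentSpace I y) {z : M} (hz : z ∈ U) :
    mpullback I I (opensRetr x₀) Z z = Z ⟨z, hz⟩ := by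
  rw [mpullback_apply, mfderiv_opensRetr_of_mem x₀ hz, opensRetr_of_mem x₀ hz]
  erw [ContinuousLinearMap.inverse_id]
  rfl

/-- **The restriction of a `C^n` vector field to an open submanifold is `C^n`.** [folklore] -/
theorem contMDiff_section_restrict [IsManifold I ∞ M] [CompleteSpace E] {n : ℕ∞ω}
    {X : (x : M) → TangentSpace I x}
    (hX : ContMDiff I I.tangent n fun x => (X x : TangentBundle I M)) :
    ContMDiff I I.tangent n fun y : U =>
      (Bundle.TotalSpace.mk' E y (restrictVF U X y) : TangentBundle I U) := by
  have h := ContMDiff.mpullback_vectorField (I := I) (I' := I) (f := (Subtype.val : U → M))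
    (V := X) (n := n + 1) hX contMDiff_subtype_val (fun y => isInvertible_mfderiv_val y) le_rfl
  rw [mpullback_val] at h
  exact h

/-- **A vector field of `M` is `C^n` at a point of `U` if its restriction to `U` is**: it agrees
near the point with the pull-back of the restriction along the retraction. [folklore] -/
theorem contMDiffAt_section_of_restrict [IsManifold I ∞ M] [CompleteSpace E] {n : ℕ∞ω}
    {Y : (x : M) → TangentSpace I x} {Z : (y : U) → TangentSpace I y}
    (hYZ : ∀ y : U, Y (y : M) = Z y) {y : U}
    (hZ : ContMDiffAt I I.tangent n (fun z : U => (Bundle.TotalSpace.mk' E z (Z z) : TangentBundle I U)) y) :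
    ContMDiffAt I I.tangent n (fun x : M => (Y x : TangentBundle I M)) (y : M) := by
  have hV : ContMDiffAt I I.tangent n
      (fun z : U => (Bundle.TotalSpace.mk' E z (Z z) : TangentBundle I U)) (opensRetr y (y : M)) := by
    rwa [opensRetr_val]
  have hinv : (mfderiv I I (opensRetr y) (y : M)).IsInvertible := by
    rw [mfderiv_opensRetr]
    exact ⟨ContinuousLinearEquiv.refl ℝ E, rfl⟩
  have key := ContMDiffAt.mpullback_vectorField_preimage (I := I) (I' := I) (f := opensRetr y)
    (V := Z) (n := n + 1) hV (contMDiffAt_opensRetr y y) hinv le_rfl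
  refine key.congr_of_eventuallyEq ?_
  filter_upwards [U.isOpen.mem_nhds y.2] with z hz
  show (Bundle.TotalSpace.mk' E z (Y z) : TangentBundle I M) =
    Bundle.TotalSpace.mk' E z (mpullback I I (opensRetr y) Z z)
  rw [mpullback_opensRetr_apply y Z hz, ← hYZ ⟨z, hz⟩]

/-- **Lie brackets on an open submanifold are the ambient Lie brackets**:
`[X|_U, Y|_U](y) = [X, Y](↑y)` for vector fields differentiable at `↑y` (Mathlib's
`VectorField.mpullback_mlieBracket` along the inclusion). [folklore] -/
theorem mlieBracket_restrict [IsManifold I ∞ M] [CompleteSpace E]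
    {X Y : (x : M) → TangentSpace I x} {y : U}
    (hX : MDifferentiableAt I I.tangent (fun x : M => (X x : TangentBundle I M)) (y : M))
    (hY : MDifferentiableAt I I.tangent (fun x : M => (Y x : TangentBundle I M)) (y : M)) :
    mlieBracket I (restrictVF U X) (restrictVF U Y) y = mlieBracket I X Y (y : M) := by
  haveI : IsManifold I (minSmoothness ℝ 2) M := by
    rw [minSmoothness_of_isRCLikeNormedField]; infer_instance
  have key := mpullback_mlieBracket (I := I) (I' := I) (f := (Subtype.val : U → M)) (V := X)
    (W := Y) (x₀ := y) (n := ∞) hX hY (contMDiff_subtype_val y)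
    (by rw [minSmoothness_of_isRCLikeNormedField]; exact ENat.LEInfty.out)
  rw [mpullback_val, mpullback_val, mpullback_val] at key
  exact key.symm

/-! #### Differential forms restricted to an open submanifold -/

/-- The inclusion `U → M` read in the charts at `y`, `↑y` is the identity near the base point
within the model half-space. [folklore] -/
theorem writtenInExtChartAt_val_eventuallyEq (y : U) :
    writtenInExtChartAt I I y (Subtype.val : U → M) =ᶠ[𝓝[range I] (extChartAt I y y)] id := by
  have h := writtenInExtChartAt_comp_val_eventuallyEq (I := I) (I' := I) U (id : M → M) y
  filter_upwards [h.filter_mono nhdsWithin_le_nhds, extChartAt_target_mem_nhdsWithin (y : M)]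
    with z hz hz'
  rw [show writtenInExtChartAt I I y (Subtype.val : U → M) =
    writtenInExtChartAt I I y ((id : M → M) ∘ Subtype.val) from rfl, hz]
  simp only [writtenInExtChartAt, id_comp, comp_apply, id]
  exact (extChartAt I (y : M)).right_inv hz'

/-- **The chart representative of a restricted form is that of the form**: for a `k`-form `β` on
`M`, the representative of `β|_U = ι^*β` in the chart of `U` at `y` agrees near the centre,
within the model half-space, with the representative of `β` in the chart of `M` at `↑y`.
[folklore] -/
theorem inChart_pullback_val_eventuallyEq [IsManifold I ∞ M] {F : Type*} [NormedAddCommGroup F]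
    [NormedSpace ℝ F] {k : ℕ} (β : Kaehler.MForm I M F k) (y : U) :
    (Kaehler.MForm.pullback (I' := I) I (Subtype.val : U → M) β).inChart y
      =ᶠ[𝓝[range I] (extChartAt I y y)] β.inChart (y : M) := by
  have hf : ∀ᶠ z in 𝓝 y, MDifferentiableAt I I (Subtype.val : U → M) z :=
    Eventually.of_forall fun z => (contMDiff_subtype_val (n := 1) z).mdifferentiableAt one_ne_zero
  have h1 := Kaehler.MForm.inChart_pullback_eventuallyEq (I := I) (I' := I) β hf
  have h2 := writtenInExtChartAt_val_eventuallyEq (I := I) (U := U) y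
  filter_upwards [h1, eventually_eventually_nhdsWithin.2 h2, h2, self_mem_nhdsWithin]
    with z hz1 hz2 hz2' hzr
  rw [hz1, Filter.EventuallyEq.fderivWithin_eq hz2 hz2', fderivWithin_id (I.uniqueDiffOn z hzr), hz2']
  ext v
  rfl

/-- **The exterior derivative of a restricted form is the restriction of the exterior
derivative**, pointwise and unconditionally: `d(β|_U) y = (dβ) ↑y` (the tree's chart-wise
`Literature.Geometry.Kaehler.mextDeriv`; both sides are the same `extDerivWithin`). [folklore] -/
theorem mextDeriv_pullback_val_apply [IsManifold I ∞ M] {F : Type*} [NormedAddCommGroup F]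
    [NormedSpace ℝ F] {k : ℕ} (β : Kaehler.MForm I M F k) (y : U) (v : Fin (k + 1) → E) :
    Kaehler.mextDeriv (Kaehler.MForm.pullback (I' := I) I (Subtype.val : U → M) β) y v =
      Kaehler.mextDeriv β (y : M) v := by
  have h := inChart_pullback_val_eventuallyEq (I := I) (U := U) β y
  rw [Kaehler.mextDeriv_eq_extDerivWithin, Kaehler.mextDeriv_eq_extDerivWithin,
    h.extDerivWithin_eq (h.self_of_nhdsWithin (mem_range_self _))]
  rfl

/-! #### Morse functions restricted to an open submanifold -/

open Literature.Topology.FourManifolds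

/-- Critical points of a restriction are the critical points of the function in `U`. [folklore] -/
theorem isMCriticalPt_comp_val_iff {f : M → ℝ} {y : U} (hf : MDifferentiableAt I 𝓘(ℝ, ℝ) f (y : M)) :
    IsMCriticalPt I (f ∘ Subtype.val) y ↔ IsMCriticalPt I f (y : M) := by
  unfold IsMCriticalPt
  rw [mfderiv_comp_val hf]
  exact Iff.rfl

/-- **The Hessian of a restriction is the Hessian** (same local representatives near the base
point, hence the same iterated `fderivWithin`). [folklore] -/
theorem mhessian_comp_val (f : M → ℝ) (y : U) : mhessian I (f ∘ Subtype.val) y = mhessian I f (y : M) := by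
  unfold mhessian
  have hw := writtenInExtChartAt_comp_val_eventuallyEq (I := I) (I' := 𝓘(ℝ, ℝ)) U f y
  have h1 : fderivWithin ℝ (writtenInExtChartAt I 𝓘(ℝ, ℝ) y (f ∘ Subtype.val)) (range I)
      =ᶠ[𝓝 (extChartAt I (y : M) (y : M))]
        fderivWithin ℝ (writtenInExtChartAt I 𝓘(ℝ, ℝ) (y : M) f) (range I) := by
    filter_upwards [hw.eventually_nhds] with z hz
    exact Filter.EventuallyEq.fderivWithin_eq_of_nhds hz
  rw [extChartAt_opens_apply, h1.fderivWithin_eq_of_nhds]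

/-- The Morse index of a restriction is the Morse index. [folklore] -/
theorem morseIndex_comp_val (f : M → ℝ) (y : U) :
    morseIndex I (f ∘ Subtype.val) y = morseIndex I f (y : M) := by
  unfold morseIndex
  rw [mhessian_comp_val]

/-- **The restriction of a Morse function to an open submanifold is a Morse function.**
[folklore] -/
theorem isMorse_comp_val {f : M → ℝ} (hf : IsMorse I f) : IsMorse I (f ∘ (Subtype.val : U → M)) := by
  refine ⟨hf.1.comp contMDiff_subtype_val, fun y hy => ?_⟩
  rw [mhessian_comp_val]
  exact hf.2 _ ((isMCriticalPt_comp_val_iff ((hf.1 (y : M)).mdifferentiableAt (by simp))).1 hy)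

/-- **The restriction of a Morse function adapted to `∂M` is adapted to `∂U = ∂M ∩ U`**
(Mathlib: the boundary points of `U` are those of `M` in `U`,
`ModelWithCorners.isBoundaryPoint_iff_isBoundaryPoint_val`). [folklore] -/
theorem isMorseAdapted_comp_val {f : M → ℝ} (hf : IsMorseAdapted I f) :
    IsMorseAdapted I (f ∘ (Subtype.val : U → M)) := by
  have hd : ∀ x, MDifferentiableAt I 𝓘(ℝ, ℝ) f x := fun x => (hf.1.1 x).mdifferentiableAt (by simp)
  refine ⟨isMorse_comp_val hf.1, fun y hy => ?_, fun y hy => ?_⟩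
  · have hy' : (y : M) ∈ I.boundary M := I.isBoundaryPoint_iff_isBoundaryPoint_val.1 hy
    obtain ⟨h1, h2⟩ := hf.2.1 _ hy'
    exact ⟨h1, fun hc => h2 ((isMCriticalPt_comp_val_iff (hd _)).1 hc)⟩
  · exact hf.2.2 _ (I.isInteriorPoint_iff_isInteriorPoint_val.1 hy)

end Opens

/-- **An open submanifold of a handlebody with handles of index `≤ k` (e.g. a union of components)
is a handlebody with handles of index `≤ k`**: restrict the presenting Morse function.
[folklore] -/
theorem isHandlebodyOfIndexLE_opens {n k : ℕ} {W : Type*} [TopologicalSpace W]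
    [ChartedSpace (EuclideanHalfSpace (n + 1)) W] (U : Opens W)
    (h : Literature.Topology.FourManifolds.IsHandlebodyOfIndexLE n k W) :
    Literature.Topology.FourManifolds.IsHandlebodyOfIndexLE n k U := by
  obtain ⟨f, hf, hidx⟩ := h
  refine ⟨f ∘ Subtype.val, isMorseAdapted_comp_val hf, fun y hy => ?_⟩
  rw [morseIndex_comp_val]
  exact hidx _ ((isMCriticalPt_comp_val_iff ((hf.1.1 (y : W)).mdifferentiableAt (by simp))).1 hy)


/-! ### §2 Connected components of a `4`-manifold with boundary as open submanifolds -/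

section Components

variable (W : Type*) [TopologicalSpace W] [ChartedSpace (EuclideanHalfSpace 4) W]

/-- A manifold with boundary is locally connected (charts into the locally path-connected
half-space). [folklore] -/
theorem locallyConnectedSpace_of_chartedSpace : LocallyConnectedSpace W := by
  haveI : LocallyPathConnectedSpace W :=
    ChartedSpace.locallyPathConnectedSpace (EuclideanHalfSpace 4) W
  infer_instance

/-- **The connected component with index `i`, as an open submanifold** (components of a locally
connected space are open). [folklore] -/
def compOpens (i : ConnectedComponents W) : Opens W :=
  ⟨ConnectedComponents.mk ⁻¹' {i}, by
    haveI := locallyConnectedSpace_of_chartedSpace W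
    obtain ⟨x, rfl⟩ := ConnectedComponents.surjective_coe i
    rw [connectedComponents_preimage_singleton]
    exact isOpen_connectedComponent⟩

variable {W}

/-- Membership in `compOpens W i`: the component of `x` is `i`. [folklore] -/
theorem mem_compOpens_iff {i : ConnectedComponents W} {x : W} :
    x ∈ compOpens W i ↔ ConnectedComponents.mk x = i :=
  Iff.rfl

/-- The carrier of the component of `x` is `connectedComponent x`. [folklore] -/
theorem coe_compOpens_mk (x : W) :
    ((compOpens W (ConnectedComponents.mk x) : Opens W) : Set W) = connectedComponent x :=
  connectedComponents_preimage_singleton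

/-- The point `x` of `W` as a point of its component. [folklore] -/
def toComp (x : W) : compOpens W (ConnectedComponents.mk x) := ⟨x, rfl⟩

/-- `toComp x` is `x`. [folklore] -/
@[simp] theorem coe_toComp (x : W) : (toComp x : W) = x := rfl

/-- Components are compact (closed in the compact `W`). [folklore] -/
instance compactSpace_compOpens [CompactSpace W] (i : ConnectedComponents W) :
    CompactSpace (compOpens W i) := by
  obtain ⟨x, rfl⟩ := ConnectedComponents.surjective_coe i
  refine isCompact_iff_compactSpace.mp ?_
  rw [coe_compOpens_mk]
  exact isClosed_connectedComponent.isCompact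

/-- Components are connected. [folklore] -/
instance connectedSpace_compOpens (i : ConnectedComponents W) : ConnectedSpace (compOpens W i) := by
  obtain ⟨x, rfl⟩ := ConnectedComponents.surjective_coe i
  refine isConnected_iff_connectedSpace.mp ?_
  rw [coe_compOpens_mk]
  exact isConnected_connectedComponent

end Components

/-! ### §3 Assembling Stein structures on the components -/

section Glue

/-- The model vector space `ℝ⁴` of the tangent spaces. [folklore] -/
local notation "E4" => EuclideanSpace ℝ (Fin 4)

variable {W : Type*} [TopologicalSpace W] [ChartedSpace (EuclideanHalfSpace 4) W]
  [IsManifold (𝓡∂ 4) ∞ W] [CompactSpace W]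
  (T : ∀ i : ConnectedComponents W, SteinStructure (compOpens W i))

/-- **The glued almost complex structure**: at `x`, that of the Stein structure of the component
of `x`. [folklore] -/
def glueJ (x : W) : E4 →L[ℝ] E4 := (T (ConnectedComponents.mk x)).J (toComp x)

/-- **The glued `J`-convex function**: on each component, that of its Stein structure,
normalised to have maximum `0`. [folklore] -/
def glueφ (x : W) : ℝ :=
  (T (ConnectedComponents.mk x)).φ (toComp x) - sSup (range (T (ConnectedComponents.mk x)).φ)

/-- On the component `i`, the glued `J` is `(T i).J`. [folklore] -/
theorem glueJ_coe {i : ConnectedComponents W} (y : compOpens W i) : glueJ T (y : W) = (T i).J y := by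
  obtain ⟨y, hy⟩ := y
  have hy' : ConnectedComponents.mk y = i := hy
  subst hy'
  rfl

/-- On the component `i`, the glued `φ` is `(T i).φ - sup (T i).φ`. [folklore] -/
theorem glueφ_coe {i : ConnectedComponents W} (y : compOpens W i) :
    glueφ T (y : W) = (T i).φ y - sSup (range (T i).φ) := by
  obtain ⟨y, hy⟩ := y
  have hy' : ConnectedComponents.mk y = i := hy
  subst hy'
  rfl

/-- The glued `φ` restricted to the component `i`. [folklore] -/
theorem glueφ_comp_val (i : ConnectedComponents W) :
    glueφ T ∘ (Subtype.val : compOpens W i → W) = (T i).φ - fun _ => sSup (range (T i).φ) :=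
  funext fun y => glueφ_coe T y

/-- `J² = -1` for the glued structure. [folklore] -/
theorem glueJ_sq (x : W) (v : E4) : glueJ T x (glueJ T x v) = -v :=
  (T (ConnectedComponents.mk x)).J_sq (toComp x) v

/-- **The glued `J` is smooth**: near `x₀` it is `(T i).J` on the open component `U ∋ x₀`, which
maps the (smooth) restriction of `X` to a smooth vector field of `U`
(`contMDiff_section_restrict`, `contMDiffAt_section_of_restrict`). [folklore] -/
theorem isSmoothVectorField_glueJ (X : (x : W) → TangentSpace (𝓡∂ 4) x)
    (hX : IsSmoothVectorField W X) : IsSmoothVectorField W fun x => glueJ T x (X x) := by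
  intro x₀
  set i := ConnectedComponents.mk x₀ with hi
  have hXr : IsSmoothVectorField (compOpens W i) (restrictVF (compOpens W i) X) :=
    contMDiff_section_restrict (U := compOpens W i) hX
  have hZ := (T i).J_smooth _ hXr
  exact contMDiffAt_section_of_restrict (U := compOpens W i) (Y := fun x => glueJ T x (X x))
    (Z := fun y => (T i).J y (restrictVF (compOpens W i) X y)) (fun y => by rw [glueJ_coe]; rfl)
    (hZ (toComp x₀))

/-- The restriction to a component of `x ↦ J_x (X x)` is `(T i).J` on the restriction.
[folklore] -/
theorem restrict_glueJ_apply (i : ConnectedComponents W) (X : (x : W) → TangentSpace (𝓡∂ 4) x) :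
    restrictVF (I := 𝓡∂ 4) (compOpens W i) (fun x => glueJ T x (X x)) =
      fun y : compOpens W i => (T i).J y (restrictVF (compOpens W i) X y) :=
  funext fun y => by rw [restrictVF_apply, glueJ_coe]; rfl

/-- **The glued `J` is integrable**: its Nijenhuis tensor at `x₀` is that of `(T i).J` on the
restrictions to the component of `x₀` (`mlieBracket_restrict`). [folklore] -/
theorem nijenhuis_glueJ_eq_zero {X Y : (x : W) → TangentSpace (𝓡∂ 4) x}
    (hX : IsSmoothVectorField W X) (hY : IsSmoothVectorField W Y) (x₀ : W) :
    nijenhuis W (glueJ T) X Y x₀ = 0 := by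
  set i := ConnectedComponents.mk x₀ with hi
  have hd : ∀ {V : (x : W) → TangentSpace (𝓡∂ 4) x}, IsSmoothVectorField W V →
      MDifferentiableAt (𝓡∂ 4) (𝓡∂ 4).tangent (fun x : W => (V x : TangentBundle (𝓡∂ 4) W)) x₀ :=
    fun h => (h x₀).mdifferentiableAt (by simp)
  have hJX := isSmoothVectorField_glueJ T X hX
  have hJY := isSmoothVectorField_glueJ T Y hY
  have hXr : IsSmoothVectorField (compOpens W i) (restrictVF (compOpens W i) X) :=
    contMDiff_section_restrict (U := compOpens W i) hX
  have hYr : IsSmoothVectorField (compOpens W i) (restrictVF (compOpens W i) Y) :=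
    contMDiff_section_restrict (U := compOpens W i) hY
  have key := (T i).integrable _ _ hXr hYr (toComp x₀)
  simp only [nijenhuis] at key ⊢
  have h1 := mlieBracket_restrict (U := compOpens W i) (y := toComp x₀) (hd hJX) (hd hJY)
  have h2 := mlieBracket_restrict (U := compOpens W i) (y := toComp x₀) (hd hJX) (hd hY)
  have h3 := mlieBracket_restrict (U := compOpens W i) (y := toComp x₀) (hd hX) (hd hJY)
  have h4 := mlieBracket_restrict (U := compOpens W i) (y := toComp x₀) (hd hX) (hd hY)
  rw [restrict_glueJ_apply] at h1 h2 h3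
  rw [restrict_glueJ_apply] at h1
  rw [coe_toComp] at h1 h2 h3 h4
  have hJ : glueJ T x₀ = (T i).J (toComp x₀) := glueJ_coe T (toComp x₀)
  rw [← h1, ← h2, ← h3, ← h4, hJ]
  exact key

/-- **The glued `φ` is smooth** (`contMDiffAt_of_comp_val`). [folklore] -/
theorem contMDiff_glueφ : ContMDiff (𝓡∂ 4) 𝓘(ℝ, ℝ) ∞ (glueφ T) := fun x₀ => by
  set i := ConnectedComponents.mk x₀ with hi
  have h : ContMDiff (𝓡∂ 4) 𝓘(ℝ, ℝ) ∞ (glueφ T ∘ (Subtype.val : compOpens W i → W)) := by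
    rw [glueφ_comp_val]
    exact (T i).φ_smooth.sub contMDiff_const
  exact contMDiffAt_of_comp_val (U := compOpens W i) (y := toComp x₀) (h _)

/-- **The differential of the glued `φ`** at a point of the component `i` is that of `(T i).φ`.
[folklore] -/
theorem mfderiv_glueφ {i : ConnectedComponents W} (y : compOpens W i) :
    mfderiv (𝓡∂ 4) 𝓘(ℝ, ℝ) (glueφ T) (y : W) = mfderiv (𝓡∂ 4) 𝓘(ℝ, ℝ) (T i).φ y := by
  have hg : MDifferentiableAt (𝓡∂ 4) 𝓘(ℝ, ℝ) (glueφ T) (y : W) :=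
    (contMDiff_glueφ T (y : W)).mdifferentiableAt (by simp)
  rw [← mfderiv_comp_val (U := compOpens W i) hg, glueφ_comp_val]
  have h := (((T i).φ_smooth y).mdifferentiableAt (by simp)).hasMFDerivAt.sub
    (hasMFDerivAt_const (I := 𝓡∂ 4) (I' := 𝓘(ℝ, ℝ)) (sSup (range (T i).φ)) y)
  exact h.mfderiv.trans (sub_zero _)

/-- The glued `d^ℂφ` restricted to the component `i` is `d^ℂ` of `(T i)`. [folklore] -/
theorem pullback_val_dComplex_glue (i : ConnectedComponents W) :
    Kaehler.MForm.pullback (I' := 𝓡∂ 4) (𝓡∂ 4) (Subtype.val : compOpens W i → W)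
        (dComplex (glueJ T) (glueφ T)) =
      dComplex (T i).J (T i).φ := by
  funext y
  ext w
  rw [Kaehler.MForm.pullback_subtypeVal_apply, dComplex_apply, dComplex_apply, mfderiv_glueφ,
    glueJ_coe]
  rfl

/-- **The Levi form of the glued structure at `x₀` is the Levi form of `(T i)` at `x₀`**
(`mextDeriv_pullback_val_apply`: the tree's chart-wise `d` of a restricted form is the
restriction of `d`). [folklore] -/
theorem mextDeriv_dComplex_glue_apply (x₀ : W) (w : Fin 2 → E4) :
    Kaehler.mextDeriv (dComplex (glueJ T) (glueφ T)) x₀ w =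
      Kaehler.mextDeriv (dComplex (T (ConnectedComponents.mk x₀)).J
        (T (ConnectedComponents.mk x₀)).φ) (toComp x₀) w := by
  rw [← pullback_val_dComplex_glue T (ConnectedComponents.mk x₀),
    mextDeriv_pullback_val_apply (U := compOpens W (ConnectedComponents.mk x₀))]
  rfl

/-- Strict `J`-convexity of the glued structure. [folklore] -/
theorem glue_convex (x₀ : W) (v : E4) (hv : v ≠ 0) :
    0 < -(Kaehler.mextDeriv (dComplex (glueJ T) (glueφ T)) x₀ ![v, glueJ T x₀ v]) := by
  rw [mextDeriv_dComplex_glue_apply]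
  have hJ : glueJ T x₀ = (T (ConnectedComponents.mk x₀)).J (toComp x₀) := glueJ_coe T (toComp x₀)
  rw [hJ]
  exact (T (ConnectedComponents.mk x₀)).convex (toComp x₀) v hv

/-- The glued `φ` is nonpositive. [folklore] -/
theorem glueφ_nonpos (x : W) : glueφ T x ≤ 0 := by
  have hb : BddAbove (range (T (ConnectedComponents.mk x)).φ) :=
    (isCompact_range (T (ConnectedComponents.mk x)).φ_smooth.continuous).bddAbove
  have := le_csSup hb (mem_range_self (toComp x))
  unfold glueφ
  linarith

/-- On every component the glued `φ` attains the value `0`. [folklore] -/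
theorem exists_glueφ_eq_zero (i : ConnectedComponents W) : ∃ x : W, glueφ T x = 0 := by
  have hc : IsCompact (range (T i).φ) := isCompact_range (T i).φ_smooth.continuous
  obtain ⟨y, hy⟩ : sSup (range (T i).φ) ∈ range (T i).φ := hc.sSup_mem (range_nonempty _)
  exact ⟨y, by rw [glueφ_coe, hy, sub_self]⟩

/-- `sup` of the glued `φ` is `0`. [folklore] -/
theorem sSup_range_glueφ : sSup (range (glueφ T)) = 0 := by
  rcases isEmpty_or_nonempty W with hW | ⟨⟨x⟩⟩
  · rw [range_eq_empty, Real.sSup_empty]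
  · obtain ⟨x₀, hx₀⟩ := exists_glueφ_eq_zero T (ConnectedComponents.mk x)
    have h1 : IsGreatest (range (glueφ T)) 0 := by
      refine ⟨⟨x₀, hx₀⟩, ?_⟩
      rintro _ ⟨z, rfl⟩
      exact glueφ_nonpos T z
    exact h1.csSup_eq

/-- **The boundary of `W` is the maximum level set of the glued `φ`** (boundary points of a
component are the boundary points of `W` in it, Mathlib's
`ModelWithCorners.isBoundaryPoint_iff_isBoundaryPoint_val`). [folklore] -/
theorem isBoundaryPoint_iff_glueφ (x : W) :
    (𝓡∂ 4).IsBoundaryPoint x ↔ glueφ T x = sSup (range (glueφ T)) := by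
  rw [sSup_range_glueφ, show x = (toComp x : W) from rfl,
    ← (𝓡∂ 4).isBoundaryPoint_iff_isBoundaryPoint_val, (T _).boundary_eq (toComp x), glueφ_coe,
    sub_eq_zero]

/-- The glued `φ` is regular on the boundary. [folklore] -/
theorem mfderiv_glueφ_ne_zero {x : W} (hx : (𝓡∂ 4).IsBoundaryPoint x) :
    mfderiv (𝓡∂ 4) 𝓘(ℝ, ℝ) (glueφ T) x ≠ 0 := by
  have hx' : (𝓡∂ 4).IsBoundaryPoint (toComp x) :=
    (𝓡∂ 4).isBoundaryPoint_iff_isBoundaryPoint_val.2 hx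
  have h := mfderiv_glueφ T (toComp x)
  rw [coe_toComp] at h
  rw [h]
  exact (T _).regular (toComp x) hx'

/-- **Stein structures on the components assemble to a Stein structure on `W`**: `J` and `φ` are
defined componentwise (`φ` normalised to have maximum `0` on every component); every axiom is
local or componentwise — smoothness and integrability of `J` and smoothness of `φ` are checked
on the open component through a point (vector fields, Lie brackets and functions restrict to
and extend from open submanifolds), the Levi form of `φ` at a point is that of the component's
structure (`mextDeriv_pullback_val_apply`), and boundary points of `W` are the boundary points
of its components. (A disjoint union of Stein domains is a Stein domain; cf. the rendering note
in `SteinHandlebodies.lean`: Gompf's `X` in Thm. 1.3 may be disconnected.) [folklore] -/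
def SteinStructure.ofComponents : SteinStructure W where
  J := glueJ T
  φ := glueφ T
  J_sq := glueJ_sq T
  J_smooth := isSmoothVectorField_glueJ T
  integrable _ _ hX hY x := nijenhuis_glueJ_eq_zero T hX hY x
  φ_smooth := contMDiff_glueφ T
  convex := glue_convex T
  boundary_eq := isBoundaryPoint_iff_glueφ T
  regular _ hx := mfderiv_glueφ_ne_zero T hx

omit T in
/-- **A compact `4`-manifold with boundary all of whose connected components are Stein domains
is a Stein domain.** [folklore] -/
theorem isSteinDomain_of_components (h : ∀ i : ConnectedComponents W, IsSteinDomain (compOpens W i)) :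
    IsSteinDomain W :=
  ⟨SteinStructure.ofComponents fun i => (h i).some⟩

end Glue

end Literature.Geometry.Symplectic
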